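import Literature.NumberTheory.EllipticCurves.DivisionFieldRamificationDividesProofs
import Literature.NumberTheory.EllipticCurves.TateModuleGaloisTransportProofs
import Literature.NumberTheory.EllipticCurves.QuadraticTwistTateFormProofs
import Literature.NumberTheory.NumberFields.RamificationIdxAlgEquiv
import HarnessLib

/-!
# Division fields at POTENTIALLY multiplicative places: the ramification index divides `2p`

`Proofs` file (theorems only: no definition, no named fact), topic `NumberTheory/EllipticCurves`;
companion of `DivisionFieldRamificationProofs` (`e(Q ∣ v) = p^k` at a multiplicative place `v ∤ p`)
and `DivisionFieldRamificationDividesProofs` (`e(Q ∣ v) ∣ p`).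

Let `E/K` be an elliptic curve over a number field, `p` a prime, `L ⊆ K̄` a finite Galois
subextension of `K` with `L ⊆ K(E[p])` (`ker ρ̄_{E,p} ≤ Gal(K̄/L)`), `v ∤ p` a finite place and `Q`
a prime of `𝓞 L` over `v`.  Suppose `E` has POTENTIALLY MULTIPLICATIVE reduction at `v`, i.e. some
quadratic twist `E^{(d)}`, `d ∈ K^×`, has multiplicative reduction at `v` — equivalently
`ord_v(j(E)) < 0` (the tree's
`WeierstrassCurve.exists_hasMultiplicativeReductionAt_quadraticTwist_of_one_lt_valuation_j`,
Silverman *ATAEC* V.5.3).  Then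

* `WeierstrassCurve.ramificationIdx_divisionField_dvd_two_mul_of_hasMultiplicativeReductionAt_quadraticTwist`
  — **`e(Q ∣ v) ∣ 2p`**;
* `WeierstrassCurve.ramificationIdx_divisionField_dvd_two_mul_of_one_lt_valuation_j` — the same
  under the hypothesis `ord_v(j(E)) < 0` (`1 < v(j)` in Mathlib's multiplicative normalisation);
* `WeierstrassCurve.not_dvd_ramificationIdx_divisionField_of_hasMultiplicativeReductionAt_quadraticTwist`
  — no prime `q ∉ {2, p}` divides `e(Q ∣ v)` (in particular `K(E[p])/K` is TAMELY ramified at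
  `v` as soon as `v ∤ 2p`).

Classical (Silverman *ATAEC* V.5, Thm. 5.3 and Ex. 5.13 (b); Serre 1972 §1.12 "`e ∣ 2p`" at the
places of potentially multiplicative reduction): `E ≅ E^{(d)}` over `K(√d)`, so on
`Γ_{K(√d)} = Stab_{Γ_K}(√d)` (index `≤ 2`, the tree's `index_stabilizer_geomSqrt`) the `p`-torsion
Galois modules of `E` and `E^{(d)}` agree (`exists_addEquiv_geomPoints_quadraticTwist_sign`); the
inertia group `I_𝔓` of a prime `𝔓 ∣ v` of `\bar ℤ_K` acts unipotently on `E^{(d)}[p]`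
(`smul_smul_sub_eq_of_mem_inertia_geomPoints`, the engine of
`exists_ramificationIdx_divisionField_eq_pow_of_hasMultiplicativeReductionAt`), so `σ^p ∈ ker ρ̄_{E,p}`
for every `σ ∈ I_𝔓 ∩ Γ_{K(√d)}`; hence the image of `I_𝔓 ∩ Γ_{K(√d)}` in `Gal(L/K)` is a `p`-group
of index dividing `2` in the image `I_P(Gal(L/K))` of `I_𝔓`, i.e. `e(Q ∣ v) = #I_P = m · p^k` with
`m ∣ 2`; finally `p^k ∣ #Gal(L/K) ∣ #Aut(E[p]) = #GL₂(𝔽_p)` forces `k ≤ 1`.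

The group-theoretic core is exported in generic form (any normal `N ≤ Γ_K` of index dividing `2`
such that `σ^p` fixes `L` for `σ ∈ I_𝔓 ∩ N`):
`Literature.NumberTheory.EllipticCurves.exists_card_inertia_comap_eq_mul_pow_of_pow_mem_fixingSubgroup_of_mem`,
together with `…restrictNormalHom_mem_inertia_comap` / `…map_restrictNormalHom_inertia_eq`
(the finite-level inertia group `I_P(Gal(L/K))` IS the image of `I_𝔓`, Neukirch *ANT* I (9.6) /
II (9.11), assembled from the tree's `exists_mem_inertia_restrict_eq`).

Consumer (cell abc-iut, sub-cell R-W «HEX-SHARP», ruling C-R29 (6) / L5-lead RULINGS #75 (1)): the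
inertia bound `e_w ≤ 2·l·e(F_v/ℚ_7)` at the places with `v_7(j) < 0` of the Legendre family.  Classical
algebraic number theory; nothing here bears on [IUTchIII] Cor. 3.12.

§ "Standalone-field currency" (v2, appended): the same bounds for an ABSTRACTLY given number field `M`,
Galois over `K`, presented inside the `p`-division field by a `K`-embedding `ψ : M → K̄` with
`ker ρ̄_{E,p} ≤ Gal(K̄/ψ(M))` — the shape in which the cell's genuine towers are typed
(`Literature.IUT.LogVolume.Cor22.exists_ramificationIdx_divisionTower_eq_pow`,
`ker_galoisRepTorsion_le_fixingSubgroup_of_initialThetaData`) — read through the tree's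
`RamificationIdxAlgEquiv` transport (`M ≃ₐ[K] ψ(M)`):
`ramificationIdx_dvd_two_mul_of_hasMultiplicativeReductionAt_quadraticTwist_of_algHom`,
`ramificationIdx_dvd_two_mul_of_one_lt_valuation_j_of_algHom`,
`not_dvd_ramificationIdx_of_hasMultiplicativeReductionAt_quadraticTwist_of_algHom`.

## References

* [SilvermanATAEC1994] J. H. Silverman, *Advanced Topics in the Arithmetic of Elliptic Curves* (1994),
  V.5 Thm. 5.3, Exercise 5.13 (b).
* [SilvermanAEC2009] J. H. Silverman, *The Arithmetic of Elliptic Curves*, 2nd ed. (2009), X.5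
  Cor. 5.4, VII.5 Prop. 5.4 (c).
* [Serre1972] J.-P. Serre, Propriétés galoisiennes des points d'ordre fini des courbes elliptiques,
  Invent. Math. 15 (1972), §1.11–§1.12.
* [NeukirchANT1999] J. Neukirch, *Algebraic Number Theory* (1999), Ch. I §9 (9.6), (9.9).
-/

noncomputable section

open scoped Pointwise IntermediateField NumberField

open NumberField IsDedekindDomain IntermediateField Field

universe u

namespace Literature.NumberTheory.EllipticCurves

section Generic

variable {K : Type u} [Field K] [NumberField K]

omit [NumberField K] in
/-- **Restriction maps absolute inertia into finite-level inertia**: for `σ ∈ I_𝔓 ≤ Γ_K` and a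
finite Galois `L ⊆ K̄`, the restriction `σ|_L` lies in the inertia group of `P = 𝔓 ∩ 𝓞 L` in
`Gal(L/K)`. [cite: NeukirchANT1999, Ch. I §9 Prop. (9.6)] -/
theorem restrictNormalHom_mem_inertia_comap (L : IntermediateField K (AlgebraicClosure K))
    [FiniteDimensional K L] [IsGalois K L]
    (𝔓 : Ideal (integralClosure (𝓞 K) (AlgebraicClosure K)))
    {σ : AlgebraicClosure K ≃ₐ[K] AlgebraicClosure K}
    (hσ : σ ∈ 𝔓.inertia (AlgebraicClosure K ≃ₐ[K] AlgebraicClosure K)) :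
    AlgEquiv.restrictNormalHom L σ ∈
      (𝔓.comap (ringOfIntegersToIntegralClosure (k := K) (Ω := AlgebraicClosure K) L)).inertia
        (L ≃ₐ[K] L) := by
  rw [Ideal.inertia, AddSubgroup.mem_inertia] at hσ ⊢
  intro x
  have h := hσ (ringOfIntegersToIntegralClosure (k := K) (Ω := AlgebraicClosure K) L x)
  rw [Submodule.mem_toAddSubgroup, Ideal.mem_comap, map_sub]
  rw [Submodule.mem_toAddSubgroup] at h
  convert h using 2
  apply Subtype.ext
  rw [integralClosure.coe_smul, coe_ringOfIntegersToIntegralClosure,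
    coe_ringOfIntegersToIntegralClosure]
  exact AlgEquiv.restrictNormalHom_apply L σ (x : L)

/-- **The finite-level inertia group is the image of absolute inertia**: for a finite Galois
`L ⊆ K̄` over `K` and a prime `𝔓` of `\bar ℤ_K`, `I_{𝔓 ∩ 𝓞 L}(Gal(L/K))` is the image of
`I_𝔓 ≤ Γ_K` under restriction (`⊆`: `restrictNormalHom_mem_inertia_comap`; `⊇`: the tree's
lifting `exists_mem_inertia_restrict_eq`). [cite: NeukirchANT1999, Ch. I §9 Prop. (9.6) and Ch. II Prop. (9.11)] -/
theorem map_restrictNormalHom_inertia_eq (L : IntermediateField K (AlgebraicClosure K))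
    [FiniteDimensional K L] [IsGalois K L]
    (𝔓 : Ideal (integralClosure (𝓞 K) (AlgebraicClosure K))) [𝔓.IsPrime] :
    (𝔓.inertia (AlgebraicClosure K ≃ₐ[K] AlgebraicClosure K)).map (AlgEquiv.restrictNormalHom L) =
      (𝔓.comap (ringOfIntegersToIntegralClosure (k := K) (Ω := AlgebraicClosure K) L)).inertia
        (L ≃ₐ[K] L) := by
  apply le_antisymm
  · rintro g ⟨σ, hσ, rfl⟩
    exact restrictNormalHom_mem_inertia_comap L 𝔓 hσ
  · intro g hg
    obtain ⟨σ, hσ, hσg⟩ := exists_mem_inertia_restrict_eq L 𝔓 g hg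
    refine ⟨σ, hσ, AlgEquiv.ext fun x ↦ Subtype.ext ?_⟩
    rw [AlgEquiv.restrictNormalHom_apply]
    exact hσg x

/-- **Index-two descent for inertia at finite level.**  Let `L ⊆ K̄` be finite Galois over `K`,
`𝔓` a prime of `\bar ℤ_K`, `p` a prime, and `N ⊴ Γ_K` a normal subgroup of index dividing `2`
[e.g. `Γ_{K(√d)}`] such that `σ^p` fixes `L` for every `σ ∈ I_𝔓 ∩ N`.  Then
`#I_{𝔓 ∩ 𝓞 L}(Gal(L/K)) = m · p^k` with `m ∣ 2`: the image of `I_𝔓 ∩ N` in `Gal(L/K)` has exponent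
`p`, so is a `p`-group, and its index in the image `I_P` of `I_𝔓` divides `[I_𝔓 : I_𝔓 ∩ N] ∣ [Γ_K : N]`.
[cite: NeukirchANT1999, Ch. I §9 Prop. (9.6)] [cite: Serre1972, §1.11–§1.12] -/
theorem exists_card_inertia_comap_eq_mul_pow_of_pow_mem_fixingSubgroup_of_mem
    (L : IntermediateField K (AlgebraicClosure K)) [FiniteDimensional K L] [IsGalois K L]
    (𝔓 : Ideal (integralClosure (𝓞 K) (AlgebraicClosure K))) [𝔓.IsPrime] {p : ℕ} (hp : p.Prime)
    (N : Subgroup (AlgebraicClosure K ≃ₐ[K] AlgebraicClosure K)) [N.Normal] (hN : N.index ∣ 2)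
    (hI : ∀ σ ∈ 𝔓.inertia (AlgebraicClosure K ≃ₐ[K] AlgebraicClosure K), σ ∈ N →
      σ ^ p ∈ L.fixingSubgroup) :
    ∃ m k : ℕ, m ∣ 2 ∧ Nat.card ((𝔓.comap (ringOfIntegersToIntegralClosure (k := K)
      (Ω := AlgebraicClosure K) L)).inertia (L ≃ₐ[K] L)) = m * p ^ k := by
  haveI : Fact p.Prime := ⟨hp⟩
  set Γ := AlgebraicClosure K ≃ₐ[K] AlgebraicClosure K
  set res : Γ →* (L ≃ₐ[K] L) := AlgEquiv.restrictNormalHom L with hres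
  set I : Subgroup Γ := 𝔓.inertia Γ with hIdef
  -- the restriction map on `I`, corestricted to its image `A = I_P(Gal(L/K))`
  set φ : I →* (L ≃ₐ[K] L) := res.comp I.subtype with hφ
  set ψ := φ.rangeRestrict with hψ
  have hψsurj : Function.Surjective ψ := φ.rangeRestrict_surjective
  have hrange : φ.range = I.map res := by
    rw [hφ, MonoidHom.range_comp, Subgroup.range_subtype]
  have hcardA : Nat.card ((𝔓.comap (ringOfIntegersToIntegralClosure (k := K)
      (Ω := AlgebraicClosure K) L)).inertia (L ≃ₐ[K] L)) = Nat.card φ.range := by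
    rw [hrange, ← map_restrictNormalHom_inertia_eq L 𝔓]
  -- the image `B` of `I ∩ N`
  set NI : Subgroup I := N.subgroupOf I with hNI
  set B : Subgroup φ.range := NI.map ψ with hB
  -- `[A : B] ∣ [I : I ∩ N] = [I N : N] ∣ [Γ : N] ∣ 2`
  have hBidx : B.index ∣ 2 := by
    calc B.index ∣ NI.index := NI.index_map_dvd hψsurj
      _ = N.relIndex I := rfl
      _ ∣ N.index := Subgroup.relIndex_dvd_index_of_normal N I
      _ ∣ 2 := hN
  -- `B` has exponent `p`
  have hker : res.ker = L.fixingSubgroup := IntermediateField.restrictNormalHom_ker L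
  have hexp : ∀ b : B, (b : φ.range) ^ p = 1 := by
    rintro ⟨b, hb⟩
    obtain ⟨σ, hσN, rfl⟩ := hb
    have hσN' : (σ : Γ) ∈ N := Subgroup.mem_subgroupOf.mp hσN
    have hσp : res ((σ : Γ) ^ p) = 1 := by
      rw [← MonoidHom.mem_ker, hker]
      exact hI σ σ.2 hσN'
    change ψ σ ^ p = 1
    rw [← map_pow]
    apply Subtype.ext
    rw [MonoidHom.coe_rangeRestrict, OneMemClass.coe_one, hφ, MonoidHom.comp_apply,
      Subgroup.coe_subtype, SubgroupClass.coe_pow]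
    exact hσp
  have hPG : IsPGroup p B := fun b ↦ ⟨1, Subtype.ext (by rw [pow_one]; exact hexp b)⟩
  obtain ⟨k, hk⟩ := IsPGroup.iff_card.mp hPG
  refine ⟨B.index, k, hBidx, ?_⟩
  rw [hcardA, ← Subgroup.card_mul_index B, hk, mul_comm]

end Generic

end Literature.NumberTheory.EllipticCurves

/-! ### Division fields of an elliptic curve at potentially multiplicative places -/

namespace WeierstrassCurve

open Literature.NumberTheory.EllipticCurves Literature.NumberTheory.GaloisRepresentations
  IsDedekindDomain.HeightOneSpectrum

variable {K : Type u} [Field K] [NumberField K] (W : WeierstrassCurve K)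

/-- If `p` is prime and `p^k ∣ (p² − 1)(p² − p) = #GL₂(𝔽_p)`, then `k ≤ 1` (the `p`-part of
`#GL₂(𝔽_p) = p (p − 1)² (p + 1)` is `p`; cf. the sibling file's private
`pow_dvd_prime_of_pow_dvd_card_GL_two`). [folklore] -/
private theorem le_one_of_pow_dvd_card_GL_two {p k : ℕ} (hp : p.Prime)
    (h : p ^ k ∣ (p ^ 2 - 1) * (p ^ 2 - p)) : k ≤ 1 := by
  -- `(p² − 1)(p² − p) = p · ((p − 1)(p + 1)(p − 1))`
  have hfac : (p ^ 2 - 1) * (p ^ 2 - p) = p * ((p - 1) * (p + 1) * (p - 1)) := by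
    have h1 : p ^ 2 - 1 = (p - 1) * (p + 1) := by
      rw [mul_comm, ← Nat.sq_sub_sq, one_pow]
    have h2 : p ^ 2 - p = p * (p - 1) := by
      rw [Nat.mul_sub, mul_one, sq]
    rw [h1, h2]; ring
  rw [hfac] at h
  have hcop1 : Nat.Coprime p (p - 1) := by
    refine (Nat.Prime.coprime_iff_not_dvd hp).mpr fun hd => ?_
    have hlt : p - 1 < p := Nat.sub_lt hp.pos one_pos
    have hpos : 0 < p - 1 := Nat.sub_pos_of_lt hp.one_lt
    exact absurd (Nat.le_of_dvd hpos hd) (not_le.mpr hlt)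
  have hcop2 : Nat.Coprime p (p + 1) := by
    refine (Nat.Prime.coprime_iff_not_dvd hp).mpr fun hd => ?_
    have : p ∣ 1 := (Nat.dvd_add_right (dvd_refl p)).mp hd
    exact hp.one_lt.ne' (Nat.dvd_one.mp this)
  have hcop : Nat.Coprime (p ^ k) ((p - 1) * (p + 1) * (p - 1)) :=
    Nat.Coprime.pow_left k ((hcop1.mul_right hcop2).mul_right hcop1)
  have h' : p ^ k ∣ p ^ 1 := by
    rw [pow_one]
    exact hcop.dvd_of_dvd_mul_right h
  exact (Nat.pow_dvd_pow_iff_le_right hp.one_lt).mp h'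

/-- **On `Γ_{K(√d)}` the unipotence of inertia transfers from `E^{(d)}[p]` to `E[p]`.**  Let `E/K`
be elliptic over a number field, `d ∈ K^×` with `E^{(d)}` of multiplicative reduction at `v ∤ p`,
`𝔓 ∣ v` a prime of `\bar ℤ_K`, and `σ ∈ I_𝔓` with `σ√d = √d`.  Then `ρ̄_{E,p}(σ)^p = 1`:
`σ` acts unipotently on `E^{(d)}[p]` (`smul_smul_sub_eq_of_mem_inertia_geomPoints`), so `σ^p` fixes
`E^{(d)}[p]`, and the `Γ_{K(√d)}`-equivariant `E^{(d)}(K̄) ≃+ E(K̄)`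
(`exists_addEquiv_geomPoints_quadraticTwist_sign`) carries this to `E[p]`.
[cite: SilvermanAEC2009, X.5 Cor. 5.4] [cite: SilvermanATAEC1994, V.5 Thm. 5.3 and Exercise 5.13 (b)] -/
theorem galoisRepTorsion_pow_eq_one_of_mem_inertia_of_hasMultiplicativeReductionAt_quadraticTwist
    [W.IsElliptic] {p : ℕ} (hp : p.Prime) {v : HeightOneSpectrum (𝓞 K)} {d : K} (hd : d ≠ 0)
    (hv : (W.quadraticTwist d).HasMultiplicativeReductionAt v) (hpv : (p : 𝓞 K) ∉ v.asIdeal)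
    {𝔓 : Ideal (absIntegers (𝓞 K) K)} (h𝔓 : 𝔓 ∈ v.primesAbove)
    {σ : absoluteGaloisGroup K} (hσ : σ ∈ 𝔓.inertia (absoluteGaloisGroup K))
    (hσd : σ • geomSqrt d = geomSqrt d) :
    W.galoisRepTorsion (p : ℤ) σ ^ p = 1 := by
  haveI : (W.quadraticTwist d).IsElliptic := W.isElliptic_quadraticTwist hd
  -- unipotence on the twist
  have hunip : ∀ P : geomTorsion (W.quadraticTwist d) (p : ℤ), σ • (σ • P - P) = σ • P - P :=
    fun P ↦ Subtype.ext (by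
      have hP : p ^ 1 • (P : geomPoints (W.quadraticTwist d)) = 0 := by
        rw [pow_one, ← natCast_zsmul]
        exact (Submodule.mem_torsionBy_iff (p : ℤ) P.1).mp P.2
      simpa only [AddSubgroupClass.coe_sub,
        Literature.NumberTheory.EllipticCurves.AddSubgroup.torsionBy.coe_smul] using
        (W.quadraticTwist d).smul_smul_sub_eq_of_mem_inertia_geomPoints hv hp hpv le_rfl h𝔓 hσ hP)
  have key : (W.quadraticTwist d).galoisRepTorsion (p : ℤ) σ ^ p = 1 :=
    (W.quadraticTwist d).galoisRepTorsion_pow_eq_one_of_unipotent hunip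
  rw [← map_pow] at key
  have key' : ∀ P : geomTorsion (W.quadraticTwist d) (p : ℤ), σ ^ p • P = P := fun P ↦ by
    rw [← galoisRepTorsion_apply, key]
    rfl
  -- transfer along the `Γ_{K(√d)}`-equivariant isomorphism
  obtain ⟨f, hfpos, -⟩ := W.exists_addEquiv_geomPoints_quadraticTwist_sign hd
  have hσpd : σ ^ p • geomSqrt d = geomSqrt d := by
    have hmem : σ ∈ MulAction.stabilizer (absoluteGaloisGroup K) (geomSqrt d) := hσd
    exact (MulAction.stabilizer (absoluteGaloisGroup K) (geomSqrt d)).pow_mem hmem p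
  rw [← map_pow]
  refine Multiplicative.toAdd.injective (AddEquiv.ext fun Q ↦ ?_)
  rw [galoisRepTorsion_apply]
  change σ ^ p • Q = Q
  -- `Q = f Q'` with `Q'` a `p`-torsion point of the twist
  have hQ' : f.symm (Q : geomPoints W) ∈ geomTorsion (W.quadraticTwist d) (p : ℤ) := by
    have h : (p : ℤ) • f.symm (Q : geomPoints W) = 0 := by
      apply f.injective
      rw [map_zsmul, AddEquiv.apply_symm_apply, map_zero]
      exact (Submodule.mem_torsionBy_iff (p : ℤ) Q.1).mp Q.2
    exact (Submodule.mem_torsionBy_iff (p : ℤ) _).mpr h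
  apply Subtype.ext
  have h1 := key' ⟨f.symm (Q : geomPoints W), hQ'⟩
  have h2 := congrArg (fun P : geomTorsion (W.quadraticTwist d) (p : ℤ) ↦
    f (P : geomPoints (W.quadraticTwist d))) h1
  simp only at h2
  change f ((σ ^ p) • f.symm (Q : geomPoints W)) = f (f.symm (Q : geomPoints W)) at h2
  rw [hfpos (σ ^ p) hσpd, AddEquiv.apply_symm_apply] at h2
  exact h2

/-- **Division fields at potentially multiplicative places `v ∤ p`: the ramification index divides
`2p`.**  Let `E/K` be an elliptic curve over a number field, `p` a prime, `L ⊆ K̄` finite Galois over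
`K` with `L ⊆ K(E[p])` (`ker ρ̄_{E,p} ≤ Gal(K̄/L)`), `v ∤ p` a finite place, and `d ∈ K^×` such that the
quadratic twist `E^{(d)}` has multiplicative reduction at `v`.  Then **`e(Q ∣ v) ∣ 2p`** for every
prime `Q` of `𝓞 L` over `v` (so `e(Q ∣ v) ∈ {1, 2, p, 2p}`): with `N = Γ_{K(√d)}` (normal of index
`≤ 2`), `σ^p ∈ ker ρ̄_{E,p}` for `σ ∈ I_𝔓 ∩ N`
(`galoisRepTorsion_pow_eq_one_of_mem_inertia_of_hasMultiplicativeReductionAt_quadraticTwist`), so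
`e = #I_P(Gal(L/K)) = m · p^k`, `m ∣ 2`
(`exists_card_inertia_comap_eq_mul_pow_of_pow_mem_fixingSubgroup_of_mem`), and
`p^k ∣ #Gal(L/K) ∣ #Aut(E[p]) = (p² − 1)(p² − p)` gives `k ≤ 1`.
[cite: Serre1972, §1.11–§1.12] [cite: SilvermanATAEC1994, V.5 Thm. 5.3 and Exercise 5.13 (b)] -/
theorem ramificationIdx_divisionField_dvd_two_mul_of_hasMultiplicativeReductionAt_quadraticTwist
    [W.IsElliptic] {p : ℕ} (hp : p.Prime) (L : IntermediateField K (AlgebraicClosure K))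
    [FiniteDimensional K L] [IsGalois K L] (hL : (W.galoisRepTorsion (p : ℤ)).ker ≤ L.fixingSubgroup)
    {v : HeightOneSpectrum (𝓞 K)} {d : K} (hd : d ≠ 0)
    (hv : (W.quadraticTwist d).HasMultiplicativeReductionAt v)
    (hpv : (p : 𝓞 K) ∉ v.asIdeal) (Q : Ideal (𝓞 L)) [Q.IsPrime] [Q.LiesOver v.asIdeal] :
    Q.ramificationIdx (𝓞 K) ∣ 2 * p := by
  obtain ⟨𝔓, h𝔓⟩ := HeightOneSpectrum.primesAbove_nonempty v
  haveI := h𝔓.1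
  haveI := h𝔓.2
  set N : Subgroup (absoluteGaloisGroup K) :=
    MulAction.stabilizer (absoluteGaloisGroup K) (geomSqrt d) with hNdef
  have hNn : N.Normal := stabilizer_geomSqrt_normal d
  have hN2 : N.index ∣ 2 := by
    rcases index_stabilizer_geomSqrt (K := K) d with h | h
    · rw [hNdef, h]; exact one_dvd 2
    · rw [hNdef, h]
  have hI : ∀ σ ∈ 𝔓.inertia (AlgebraicClosure K ≃ₐ[K] AlgebraicClosure K), σ ∈ N →
      σ ^ p ∈ L.fixingSubgroup := by
    intro σ hσ hσN
    apply hL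
    -- read `σ` in the tree's `absoluteGaloisGroup K` (same type, instance-friendly name)
    set τ : absoluteGaloisGroup K := σ with hτdef
    have hτ : τ ∈ 𝔓.inertia (absoluteGaloisGroup K) := hσ
    have hτd : τ • geomSqrt d = geomSqrt d := hσN
    have key :=
      W.galoisRepTorsion_pow_eq_one_of_mem_inertia_of_hasMultiplicativeReductionAt_quadraticTwist
        hp hd hv hpv h𝔓 hτ hτd
    exact (MonoidHom.mem_ker).mpr ((map_pow (W.galoisRepTorsion (p : ℤ)) τ p).trans key)
  obtain ⟨m, k, hm, hmk⟩ :=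
    @exists_card_inertia_comap_eq_mul_pow_of_pow_mem_fixingSubgroup_of_mem K _ _ L _ _ 𝔓 h𝔓.1 p
      hp N hNn hN2 hI
  have he : Q.ramificationIdx (𝓞 K) = m * p ^ k := by
    rw [@ramificationIdx_eq_card_inertia_comap K _ _ L _ _ v 𝔓 h𝔓.1 h𝔓.2 Q _ _, hmk]
  -- `p^k ∣ e ∣ #Gal(L/K) ∣ #Aut(E[p]) = (p² − 1)(p² − p)`
  have hdvdG : Q.ramificationIdx (𝓞 K) ∣ Nat.card (L ≃ₐ[K] L) := by
    rw [@ramificationIdx_eq_card_inertia_comap K _ _ L _ _ v 𝔓 h𝔓.1 h𝔓.2 Q _ _]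
    exact Subgroup.card_subgroup_dvd_card _
  have hGdvd : Nat.card (L ≃ₐ[K] L) ∣ (p ^ 2 - 1) * (p ^ 2 - p) := by
    have h := natCard_algEquiv_dvd_natCard_of_ker_le_fixingSubgroup L (W.galoisRepTorsion (p : ℤ)) hL
    rwa [show Nat.card (Multiplicative (AddAut (W.geomTorsion (p : ℤ)))) =
        Nat.card (AddAut (W.geomTorsion (p : ℤ))) from Nat.card_congr Multiplicative.toAdd,
      W.natCard_addAut_geomTorsion hp] at h
  have hk1 : k ≤ 1 :=
    le_one_of_pow_dvd_card_GL_two hp ((Dvd.intro_left m he.symm).trans (hdvdG.trans hGdvd))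
  have hpk : p ^ k ∣ p := by
    calc p ^ k ∣ p ^ 1 := Nat.pow_dvd_pow p hk1
      _ = p := pow_one p
  rw [he]
  exact mul_dvd_mul hm hpk

/-- **`ord_v(j(E)) < 0`, `v ∤ p` ⇒ `e(Q ∣ v) ∣ 2p` in `K(E[p])`.**  At a place with
`ord_v(j(E)) < 0` (Mathlib normalisation: `1 < v(j)`) some quadratic twist of `E` has multiplicative
reduction (the tree's `exists_hasMultiplicativeReductionAt_quadraticTwist_of_one_lt_valuation_j`,
Silverman *ATAEC* V.5.3), and the previous theorem applies.
[cite: Serre1972, §1.11–§1.12] [cite: SilvermanATAEC1994, V.5 Thm. 5.3 and Exercise 5.13 (b)] -/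
theorem ramificationIdx_divisionField_dvd_two_mul_of_one_lt_valuation_j
    [W.IsElliptic] {p : ℕ} (hp : p.Prime) (L : IntermediateField K (AlgebraicClosure K))
    [FiniteDimensional K L] [IsGalois K L] (hL : (W.galoisRepTorsion (p : ℤ)).ker ≤ L.fixingSubgroup)
    {v : HeightOneSpectrum (𝓞 K)} (hj : 1 < v.valuation K W.j)
    (hpv : (p : 𝓞 K) ∉ v.asIdeal) (Q : Ideal (𝓞 L)) [Q.IsPrime] [Q.LiesOver v.asIdeal] :
    Q.ramificationIdx (𝓞 K) ∣ 2 * p := by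
  obtain ⟨d, hd, hv⟩ := W.exists_hasMultiplicativeReductionAt_quadraticTwist_of_one_lt_valuation_j v hj
  exact W.ramificationIdx_divisionField_dvd_two_mul_of_hasMultiplicativeReductionAt_quadraticTwist
    hp L hL hd hv hpv Q

/-- Under the hypotheses of
`ramificationIdx_divisionField_dvd_two_mul_of_hasMultiplicativeReductionAt_quadraticTwist`, **no prime
`q ∉ {2, p}` divides `e(Q ∣ v)`** — in particular the residue characteristic of `v` does not when
`v ∤ 2p`: `K(E[p])/K` is TAMELY ramified at the potentially multiplicative places away from `2p`.
[cite: Serre1972, §1.11–§1.12] -/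
theorem not_dvd_ramificationIdx_divisionField_of_hasMultiplicativeReductionAt_quadraticTwist
    [W.IsElliptic] {p : ℕ} (hp : p.Prime) (L : IntermediateField K (AlgebraicClosure K))
    [FiniteDimensional K L] [IsGalois K L] (hL : (W.galoisRepTorsion (p : ℤ)).ker ≤ L.fixingSubgroup)
    {v : HeightOneSpectrum (𝓞 K)} {d : K} (hd : d ≠ 0)
    (hv : (W.quadraticTwist d).HasMultiplicativeReductionAt v)
    (hpv : (p : 𝓞 K) ∉ v.asIdeal) (Q : Ideal (𝓞 L)) [Q.IsPrime] [Q.LiesOver v.asIdeal]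
    {q : ℕ} (hq : q.Prime) (hq2 : q ≠ 2) (hqp : q ≠ p) :
    ¬ q ∣ Q.ramificationIdx (𝓞 K) := by
  intro h
  have h2p := h.trans
    (W.ramificationIdx_divisionField_dvd_two_mul_of_hasMultiplicativeReductionAt_quadraticTwist
      hp L hL hd hv hpv Q)
  rcases (Nat.Prime.dvd_mul hq).mp h2p with h2 | hpp
  · exact hq2 ((Nat.prime_dvd_prime_iff_eq hq Nat.prime_two).mp h2)
  · exact hqp ((Nat.prime_dvd_prime_iff_eq hq hp).mp hpp)

/-! ### Standalone-field currency: `M/K` Galois presented inside `K(E[p])` by `ψ : M → K̄` -/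

section AlgHom

open Literature.NumberTheory.NumberFields

variable {M : Type u} [Field M] [NumberField M] [Algebra K M]

/-- **`e(u ∣ v) ∣ 2p` for an abstractly given `M/K`.**  Let `E/K` be elliptic over a number field, `p`
prime, `M` a number field Galois over `K` with a `K`-embedding `ψ : M → K̄` whose image is fixed by
`ker ρ̄_{E,p}` (i.e. `M ⊆ K(E[p])` up to `K`-isomorphism), `v ∤ p` a place of `K` at which some quadratic
twist `E^{(d)}` has multiplicative reduction, and `u` a place of `M` over `v`.  Then `e(u ∣ v) ∣ 2p`
(`ramificationIdx_divisionField_dvd_two_mul_of_hasMultiplicativeReductionAt_quadraticTwist` for the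
subfield `ψ(M) ⊆ K̄`, transported along `M ≃ₐ[K] ψ(M)` by the tree's `ramificationIdx_map_mapAlgEquiv`).
[cite: Serre1972, §1.11–§1.12] [cite: NeukirchANT1999, Ch. I §8 (8.2)] -/
theorem ramificationIdx_dvd_two_mul_of_hasMultiplicativeReductionAt_quadraticTwist_of_algHom
    [W.IsElliptic] {p : ℕ} (hp : p.Prime) [IsGalois K M] (ψ : M →ₐ[K] AlgebraicClosure K)
    (hM : (W.galoisRepTorsion (p : ℤ)).ker ≤ ψ.fieldRange.fixingSubgroup)
    {v : HeightOneSpectrum (𝓞 K)} {d : K} (hd : d ≠ 0)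
    (hv : (W.quadraticTwist d).HasMultiplicativeReductionAt v) (hpv : (p : 𝓞 K) ∉ v.asIdeal)
    (u : HeightOneSpectrum (𝓞 M)) [u.asIdeal.LiesOver v.asIdeal] :
    u.asIdeal.ramificationIdx (𝓞 K) ∣ 2 * p := by
  haveI : FiniteDimensional K M := Module.Finite.of_restrictScalars_finite ℚ K M
  let e : M ≃ₐ[K] ψ.fieldRange :=
    ((IntermediateField.topEquiv (F := K) (E := M)).symm.trans (IntermediateField.equivMap ⊤ ψ)).trans
      (IntermediateField.equivOfEq (AlgHom.fieldRange_eq_map ψ).symm)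
  haveI : FiniteDimensional K ψ.fieldRange := LinearEquiv.finiteDimensional e.toLinearEquiv
  haveI : IsGalois K ψ.fieldRange := IsGalois.of_algEquiv e
  haveI : NumberField ψ.fieldRange := NumberField.of_module_finite K ψ.fieldRange
  set Q : Ideal (𝓞 ψ.fieldRange) :=
    u.asIdeal.map (RingOfIntegers.mapAlgEquiv e : 𝓞 M ≃ₐ[𝓞 K] 𝓞 ψ.fieldRange) with hQ
  haveI : Q.IsPrime := isPrime_map_mapAlgEquiv e u
  haveI : Q.LiesOver v.asIdeal := liesOver_map_mapAlgEquiv e u _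
  rw [← ramificationIdx_map_mapAlgEquiv e u]
  exact W.ramificationIdx_divisionField_dvd_two_mul_of_hasMultiplicativeReductionAt_quadraticTwist hp
    ψ.fieldRange hM hd hv hpv Q

/-- **`e(u ∣ v) ∣ 2p` for an abstractly given `M/K` at a place with `ord_v(j(E)) < 0`** (Mathlib
normalisation `1 < v(j)`), `v ∤ p`. [cite: Serre1972, §1.11–§1.12]
[cite: SilvermanATAEC1994, V.5 Thm. 5.3 and Exercise 5.13 (b)] -/
theorem ramificationIdx_dvd_two_mul_of_one_lt_valuation_j_of_algHom
    [W.IsElliptic] {p : ℕ} (hp : p.Prime) [IsGalois K M] (ψ : M →ₐ[K] AlgebraicClosure K)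
    (hM : (W.galoisRepTorsion (p : ℤ)).ker ≤ ψ.fieldRange.fixingSubgroup)
    {v : HeightOneSpectrum (𝓞 K)} (hj : 1 < v.valuation K W.j) (hpv : (p : 𝓞 K) ∉ v.asIdeal)
    (u : HeightOneSpectrum (𝓞 M)) [u.asIdeal.LiesOver v.asIdeal] :
    u.asIdeal.ramificationIdx (𝓞 K) ∣ 2 * p := by
  obtain ⟨d, hd, hv⟩ := W.exists_hasMultiplicativeReductionAt_quadraticTwist_of_one_lt_valuation_j v hj
  exact W.ramificationIdx_dvd_two_mul_of_hasMultiplicativeReductionAt_quadraticTwist_of_algHom hp ψ hM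
    hd hv hpv u

/-- **No prime `q ∉ {2, p}` divides `e(u ∣ v)`** for an abstractly given `M/K` at a potentially
multiplicative place `v ∤ p` (tameness away from `2p`). [cite: Serre1972, §1.11–§1.12] -/
theorem not_dvd_ramificationIdx_of_hasMultiplicativeReductionAt_quadraticTwist_of_algHom
    [W.IsElliptic] {p : ℕ} (hp : p.Prime) [IsGalois K M] (ψ : M →ₐ[K] AlgebraicClosure K)
    (hM : (W.galoisRepTorsion (p : ℤ)).ker ≤ ψ.fieldRange.fixingSubgroup)
    {v : HeightOneSpectrum (𝓞 K)} {d : K} (hd : d ≠ 0)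
    (hv : (W.quadraticTwist d).HasMultiplicativeReductionAt v) (hpv : (p : 𝓞 K) ∉ v.asIdeal)
    (u : HeightOneSpectrum (𝓞 M)) [u.asIdeal.LiesOver v.asIdeal]
    {q : ℕ} (hq : q.Prime) (hq2 : q ≠ 2) (hqp : q ≠ p) :
    ¬ q ∣ u.asIdeal.ramificationIdx (𝓞 K) := by
  intro h
  have h2p := h.trans
    (W.ramificationIdx_dvd_two_mul_of_hasMultiplicativeReductionAt_quadraticTwist_of_algHom hp ψ hM
      hd hv hpv u)
  rcases (Nat.Prime.dvd_mul hq).mp h2p with h2 | hpp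
  · exact hq2 ((Nat.prime_dvd_prime_iff_eq hq Nat.prime_two).mp h2)
  · exact hqp ((Nat.prime_dvd_prime_iff_eq hq hp).mp hpp)

end AlgHom

end WeierstrassCurve

end
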